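import Mathlib
import Literature.AlgebraicGeometry.Ramification.InertiaNormalSylow
import HarnessLib

/-!
# Inertia is trivial over the étale locus (crux `WildQuotients.WildQuotientResolution`, Phase 0)

Crux stmt-ResolutionOfSingularities-15640 (`WildQuotientResolution`), line `Sketch`, registered stub
`stub_phaseZeroHighDim` (Phase 0, "Sylow separation": make every inertia group p-closed). The crux's
data are a finite group `G` acting FAITHFULLY (`ρ` injective) on an INTEGRAL `X′` over `X₁` through a
`G`-invariant `q : X′ → X₁` (`ρ g ≫ q = q`) which is ÉTALE over a dense open `U ⊆ X₁`
(`Etale (q ∣_ U)`). This file proves the rigidity statement that locates the whole Phase-0 problem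
over the branch locus `X₁ ∖ U`:

**Theorem** (`inertiaSubgroup_eq_bot_of_etale`). For every point `x` of `X′` with `q x ∈ U` the
inertia group `I_x` (Abbes–Saito 2011, 2.4; the tree's `inertiaSubgroup`) is trivial.

Hence over `U` every inertia group is p-closed (`hasNormalSylow_inertiaSubgroup_of_etale`) and the
non-p-closed locus of `X′` lies in `q⁻¹(X₁ ∖ U)` (`not_mem_of_not_hasNormalSylow`). This generalises
the tree's `PhaseZeroDimOne.inertiaSubgroup_genericPoint_eq_bot` (the generic point) and is the
upstairs form of "a Galois cover is unramified over its étale locus" (cf. the tree's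
`IsGaloisTorsor.inertiaSubgroup_eq_bot`, which ASSUMES the torsor structure; here it is derived from
faithfulness + integrality, the hypotheses the crux actually carries) — step R1 of the reduction of
Phase 0 to Abbes–Saito 2011 Prop. 2.22 (memo PHASE0-AS2011.md on the item).

Proof (rigidity of unramified separated morphisms). Let `V = q⁻¹U`, `f = q|_V : V → X₁` (étale, so
its diagonal `Δ_f : V → V ×_{X₁} V` is an OPEN immersion, Mathlib `isOpenImmersion_diagonal`). An
element `g ∈ I_x` restricts to `a : V → V` over `X₁` (`V` is `G`-stable as `q` is invariant); the
equaliser of `a` and `𝟙_V`, the pullback of `Δ_f` along `(a, 𝟙)`, is an open subscheme `E ⊆ V`, and it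
contains `x` because `g` fixes the canonical point `Spec κ(x) → X′` (the definition of `I_x`). As `V`
is integral, `E` is dense, so `a = 𝟙_V` (`ext_of_isDominant_of_isSeparated`, `f` separated); as `V` is
dense in `X′`, `ρ g = 𝟙` (same lemma for `q`), and `g = 1` by faithfulness.

[OURS · crux stmt-ResolutionOfSingularities-15640 · helper toward `stub_phaseZeroHighDim`; folklore
(SGA 1 I 5.4-type rigidity), counted 0; AI-level work, weaker than expert review.]
-/

-- single-problem summit: the doubled namespace component `ResolutionOfSingularities` is forced
set_option linter.dupNamespace false

noncomputable section

open CategoryTheory CategoryTheory.Limits AlgebraicGeometry TopologicalSpace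
open Literature.AlgebraicGeometry.Ramification

namespace Summit.ResolutionOfSingularities.ResolutionOfSingularities.Theorems.WildQuotientResolution.EtaleLocusInertia

variable {X' X₁ : Scheme.{0}} {G : Type} [Group G]

/-- An endomorphism `a` of an integral scheme `V` over a base, `a ≫ f = f` with `f` UNRAMIFIED
(formally unramified, locally of finite type) and separated, which fixes the canonical point
`Spec κ(v) → V` of some point `v`, is the identity: the equaliser of `a` and `𝟙` is the pullback of
the open immersion `Δ_f`, an open subscheme containing `v`, hence dense. [folklore; cf. SGA1, Exp. I, Cor. 5.4] -/
theorem eq_id_of_fromSpecResidueField_comp_eq {V S : Scheme.{0}} [IsIntegral V] (f : V ⟶ S)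
    [FormallyUnramified f] [LocallyOfFiniteType f] [IsSeparated f] (a : V ⟶ V) (ha : a ≫ f = f)
    (v : V) (hv : V.fromSpecResidueField v ≫ a = V.fromSpecResidueField v) : a = 𝟙 V := by
  -- the pair `m = (a, 𝟙) : V → V ×_S V` and the equaliser `E = m⁻¹ Δ_f`
  obtain ⟨m, hm1, hm2⟩ : ∃ m : V ⟶ pullback f f, m ≫ pullback.fst f f = a ∧ m ≫ pullback.snd f f = 𝟙 V :=
    ⟨pullback.lift a (𝟙 V) (by rw [ha, Category.id_comp]), pullback.lift_fst _ _ _, pullback.lift_snd _ _ _⟩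
  obtain ⟨E, e, e', he⟩ : ∃ (E : Scheme.{0}) (e : E ⟶ V) (_ : IsOpenImmersion e), e ≫ a = e ≫ 𝟙 V ∧
      ∀ {T : Scheme.{0}} (t : T ⟶ V), t ≫ a = t → ∃ l : T ⟶ E, l ≫ e = t := by
    refine ⟨pullback m (pullback.diagonal f), pullback.fst m (pullback.diagonal f), inferInstance, ?_, ?_⟩
    · have hc := pullback.condition (f := m) (g := pullback.diagonal f)
      have h1 := congrArg (· ≫ pullback.fst f f) hc
      have h2 := congrArg (· ≫ pullback.snd f f) hc
      simp only [Category.assoc, hm1, hm2, pullback.diagonal_fst, pullback.diagonal_snd,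
        Category.comp_id] at h1 h2
      rw [h1, Category.comp_id, h2]
    · intro T t ht
      refine ⟨pullback.lift t t ?_, pullback.lift_fst _ _ _⟩
      apply pullback.hom_ext
      · rw [Category.assoc, hm1, ht, Category.assoc, pullback.diagonal_fst, Category.comp_id]
      · rw [Category.assoc, hm2, Category.comp_id, Category.assoc, pullback.diagonal_snd,
          Category.comp_id]
  -- `E` contains `v`: the canonical point of `v` equalises `a` and `𝟙`
  have hvE : v ∈ Set.range e := by
    obtain ⟨l, hl⟩ := he.2 (V.fromSpecResidueField v) hv
    exact ⟨l (IsLocalRing.closedPoint _), by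
      rw [← Scheme.Hom.comp_apply, hl, Scheme.fromSpecResidueField_apply]⟩
  -- `E ⊆ V` is open and non-empty in the irreducible `V`, hence dense
  haveI : IsDominant e := ⟨e.isOpenEmbedding.isOpen_range.dense ⟨v, hvE⟩⟩
  exact ext_of_isDominant_of_isSeparated f (by rw [ha, Category.id_comp]) e he.1

/-- **Inertia is trivial over the étale locus.** Let the group `G` act faithfully (`ρ` injective) on
the integral scheme `X′` over `X₁` through the `G`-invariant `q` (`ρ g ≫ q = q`, `q` separated — e.g.
affine, finite), and let `q` be étale over the open `U ⊆ X₁` (`Etale (q ∣_ U)`). Then the inertia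
group of every point `x` with `q x ∈ U` is trivial: an element of `I_x` is the identity on the dense
open `q⁻¹U` by rigidity (`eq_id_of_fromSpecResidueField_comp_eq`), hence on `X′`, hence `1`.
[folklore; cf. AbbesSaito2011, 2.4 and SGA1, Exp. V] -/
theorem inertiaSubgroup_eq_bot_of_etale [IsIntegral X'] (q : X' ⟶ X₁) [IsSeparated q]
    (ρ : G →* Aut X') (hfaith : Function.Injective ρ) (hρ : ∀ g : G, (ρ g).hom ≫ q = q)
    (U : X₁.Opens) [Etale (q ∣_ U)] (x : X') (hx : q.base x ∈ U) :
    inertiaSubgroup ρ x = ⊥ := by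
  rw [eq_bot_iff]
  intro g hg
  rw [Subgroup.mem_bot]
  have hgx := (mem_inertiaSubgroup_iff ρ).mp hg
  -- the `G`-stable dense open `V = q⁻¹ U` and the étale `f = q|_V : V → X₁`
  have hxV : x ∈ q ⁻¹ᵁ U := hx
  haveI : Nonempty ((q ⁻¹ᵁ U : X'.Opens) : Scheme.{0}) := ⟨⟨x, hxV⟩⟩
  haveI : IsIntegral ((q ⁻¹ᵁ U : X'.Opens) : Scheme.{0}) := isIntegral_of_isOpenImmersion (q ⁻¹ᵁ U).ι
  have hf : (q ∣_ U) ≫ U.ι = (q ⁻¹ᵁ U).ι ≫ q := morphismRestrict_ι q U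
  -- `ρ g` restricts to `a : V → V` through the open immersion `V.ι`
  have hVg : (ρ g).hom ⁻¹ᵁ (q ⁻¹ᵁ U) = q ⁻¹ᵁ U := by
    rw [← Scheme.Hom.comp_preimage, hρ g]
  have hrange : Set.range ⇑((q ⁻¹ᵁ U).ι ≫ (ρ g).hom) ⊆ Set.range ⇑(q ⁻¹ᵁ U).ι := by
    rintro _ ⟨v, rfl⟩
    rw [Scheme.Opens.range_ι]
    have hv' : ((q ⁻¹ᵁ U).ι v : X') ∈ (ρ g).hom ⁻¹ᵁ (q ⁻¹ᵁ U) := by rw [hVg]; exact v.2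
    exact hv'
  set a : ((q ⁻¹ᵁ U : X'.Opens) : Scheme.{0}) ⟶ ((q ⁻¹ᵁ U : X'.Opens) : Scheme.{0}) :=
    IsOpenImmersion.lift (q ⁻¹ᵁ U).ι ((q ⁻¹ᵁ U).ι ≫ (ρ g).hom) hrange
  have ha : a ≫ (q ⁻¹ᵁ U).ι = (q ⁻¹ᵁ U).ι ≫ (ρ g).hom := IsOpenImmersion.lift_fac _ _ _
  -- `a` is over `X₁` and fixes the canonical point of `x`
  have haf : a ≫ ((q ∣_ U) ≫ U.ι) = (q ∣_ U) ≫ U.ι := by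
    rw [hf, ← Category.assoc, ha, Category.assoc, hρ g]
  have hax : ((q ⁻¹ᵁ U : X'.Opens) : Scheme.{0}).fromSpecResidueField ⟨x, hxV⟩ ≫ a =
      ((q ⁻¹ᵁ U : X'.Opens) : Scheme.{0}).fromSpecResidueField ⟨x, hxV⟩ := by
    rw [← cancel_mono (q ⁻¹ᵁ U).ι, Category.assoc, ha, ← Category.assoc,
      ← Scheme.Hom.SpecMap_residueFieldMap_fromSpecResidueField, Category.assoc]
    exact congrArg (Spec.map ((q ⁻¹ᵁ U).ι.residueFieldMap ⟨x, hxV⟩) ≫ ·) hgx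
  -- rigidity on `V`, then density of `V` in `X′`, then faithfulness
  have ha1 : a = 𝟙 _ := eq_id_of_fromSpecResidueField_comp_eq ((q ∣_ U) ≫ U.ι) a haf ⟨x, hxV⟩ hax
  have hV : (q ⁻¹ᵁ U).ι ≫ (ρ g).hom = (q ⁻¹ᵁ U).ι ≫ 𝟙 X' := by
    rw [← ha, ha1, Category.id_comp, Category.comp_id]
  haveI : IsDominant (q ⁻¹ᵁ U).ι :=
    AlgebraicGeometry.Opens.isDominant_ι ((q ⁻¹ᵁ U).2.dense ⟨x, hxV⟩)
  have hg1 : (ρ g).hom = 𝟙 X' :=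
    ext_of_isDominant_of_isSeparated q (by rw [hρ, Category.id_comp]) (q ⁻¹ᵁ U).ι hV
  apply hfaith
  rw [map_one]
  exact Aut.ext hg1

/-- **Over the étale locus every inertia group is p-closed** (it is trivial).
[folklore; cf. AbbesSaito2011, Def. 2.12] -/
theorem hasNormalSylow_inertiaSubgroup_of_etale (p : ℕ) [Fact p.Prime] [IsIntegral X']
    (q : X' ⟶ X₁) [IsSeparated q] (ρ : G →* Aut X') (hfaith : Function.Injective ρ)
    (hρ : ∀ g : G, (ρ g).hom ≫ q = q) (U : X₁.Opens) [Etale (q ∣_ U)] (x : X')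
    (hx : q.base x ∈ U) : HasNormalSylow p (inertiaSubgroup ρ x) := by
  rw [inertiaSubgroup_eq_bot_of_etale q ρ hfaith hρ U x hx]
  exact HasNormalSylow.of_isPGroup IsPGroup.of_bot

/-- **The non-p-closed locus lies over the branch locus**: a point of `X′` whose inertia group is
not p-closed maps to the complement of the étale locus `U`. This is where Phase 0 (and Abbes–Saito's
`U`-admissible blow-up, Prop. 2.22) has to work. [folklore] -/
theorem not_mem_of_not_hasNormalSylow (p : ℕ) [Fact p.Prime] [IsIntegral X'] (q : X' ⟶ X₁)
    [IsSeparated q] (ρ : G →* Aut X') (hfaith : Function.Injective ρ)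
    (hρ : ∀ g : G, (ρ g).hom ≫ q = q) (U : X₁.Opens) [Etale (q ∣_ U)] (x : X')
    (hx : ¬ HasNormalSylow p (inertiaSubgroup ρ x)) : q.base x ∉ U := fun h =>
  hx (hasNormalSylow_inertiaSubgroup_of_etale p q ρ hfaith hρ U x h)

end Summit.ResolutionOfSingularities.ResolutionOfSingularities.Theorems.WildQuotientResolution.EtaleLocusInertia

end
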